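import Literature.AlgebraicGeometry.Motives.MixedHodgeStructureIndecomposableDual
import HarnessLib

/-!
# Maximal sub-MHS, simple quotients, and `rad H = ⋂ {maximal sub-MHS}`

Dual to "the socle is the sum of the simple sub-objects" (the tree's `socle_toSubmodule_eq_iSup`): in the abelian
category of mixed Hodge structures (Cattani–El Zein–Griffiths–Lê, *Hodge Theory*, Thm. 3.2.18; semisimple objects
p. 270) the radical of an object on a finite-dimensional space is the intersection of its maximal sub-objects, i.e.
of the sub-MHS with simple quotient. The proof is by Fujiki duality ((1.6.2); the tree's `annihilator` /
`coannihilator`, `rad H = (soc H^∨)_⊥`): maximal sub-MHS of `H` are the orthogonals of simple sub-MHS of `H^∨`.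
Namespace `MixedHodgeStructure`; everything proved, no named facts:

* §1 `M` has simple quotient iff `M^⊥ ⊆ H^∨` is simple; such `M` exist in non-zero `H`; they are exactly the
  co-atoms of the lattice of sub-MHS (`eq_or_eq_top_of_le`, `isSimple_quotient_of_forall_eq_or_eq_top`).
* §2 **`radical_toSubmodule_eq_iInf`**: `rad H = ⋂_{H/M simple} M`; `mem_radical_iff`.

## References

* [CattaniElZeinGriffithsLe2014] E. Cattani et al. (eds.), Hodge Theory (2014), Thm. 3.2.18, Lemma 3.2.20, p. 270.
* [Fujiki1980] A. Fujiki, Duality of mixed Hodge structures of algebraic varieties (1980), (1.6.2).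
-/

noncomputable section

namespace Literature.AlgebraicGeometry.Motives

namespace MixedHodgeStructure

universe u

variable {V : Type u} [AddCommGroup V] [Module ℚ V] [FiniteDimensional ℚ V]
variable {H : MixedHodgeStructure V}

open Module

/-! ### §1 Sub-MHS with simple quotient -/

namespace SubMixedHodgeStructure

/-- **`H/M` is simple iff `M^⊥ ⊆ H^∨` is** (`(H/M)^∨ ≅ M^⊥`). [cite: Fujiki1980, (1.6.2) b)] [cite: CattaniElZeinGriffithsLe2014, p. 270] -/
theorem isSimple_annihilator_iff (M : SubMixedHodgeStructure H) :
    M.annihilator.toMixedHodgeStructure.IsSimple ↔ M.quotient.IsSimple :=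
  (isSimple_iff_of_bijective M.quotientDualHom M.quotientDualHom_bijective).symm.trans isSimple_dual_iff

/-- `H/S'_⊥` is simple iff `S' ⊆ H^∨` is. [cite: Fujiki1980, (1.6.2) b)] [cite: CattaniElZeinGriffithsLe2014, p. 270] -/
theorem isSimple_coannihilator_quotient_iff (S' : SubMixedHodgeStructure H.dual) :
    S'.coannihilator.quotient.IsSimple ↔ S'.toMixedHodgeStructure.IsSimple := by
  rw [← isSimple_annihilator_iff, annihilator_coannihilator]

omit [FiniteDimensional ℚ V] in
/-- A sub-MHS with simple quotient is proper. [cite: CattaniElZeinGriffithsLe2014, p. 270] -/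
theorem ne_top_of_isSimple_quotient (M : SubMixedHodgeStructure H) (hM : M.quotient.IsSimple) : M.toSubmodule ≠ ⊤ := by
  haveI := hM.nontrivial
  exact Submodule.Quotient.nontrivial_iff.1 inferInstance

omit [FiniteDimensional ℚ V] in
/-- **A sub-MHS with simple quotient is a co-atom**: `M ⊆ T` forces `T = M` or `T = H`. [cite: CattaniElZeinGriffithsLe2014, p. 270] -/
theorem eq_or_eq_top_of_le {M : SubMixedHodgeStructure H} (hM : M.quotient.IsSimple) (T : SubMixedHodgeStructure H)
    (h : M.toSubmodule ≤ T.toSubmodule) : T.toSubmodule = M.toSubmodule ∨ T.toSubmodule = ⊤ := by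
  rcases hM.eq_bot_or_eq_top (T.map M.mkQ) with h' | h' <;> rw [map_toSubmodule] at h'
  · refine Or.inl (le_antisymm (fun x hx => ?_) h)
    have h0 : M.mkQ.toLinearMap x ∈ T.toSubmodule.map M.mkQ.toLinearMap := ⟨x, hx, rfl⟩
    rw [h', Submodule.mem_bot] at h0
    exact (Submodule.Quotient.mk_eq_zero _).1 h0
  · refine Or.inr (eq_top_iff.2 fun x _ => ?_)
    have hx : M.mkQ.toLinearMap x ∈ T.toSubmodule.map M.mkQ.toLinearMap := by rw [h']; exact Submodule.mem_top
    obtain ⟨t, ht, htx⟩ := hx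
    have hxt : x - t ∈ M.toSubmodule := by
      rw [← Submodule.Quotient.mk_eq_zero, Submodule.Quotient.mk_sub]
      exact sub_eq_zero.2 htx.symm
    have hsum := T.toSubmodule.add_mem (h hxt) ht
    rwa [sub_add_cancel] at hsum

omit [FiniteDimensional ℚ V] in
/-- **Conversely a proper co-atom has simple quotient** (sub-MHS of `H/M` are the `T/M`, `M ⊆ T`).
[cite: CattaniElZeinGriffithsLe2014, Lemma 3.2.20 and p. 270] -/
theorem isSimple_quotient_of_forall_eq_or_eq_top (M : SubMixedHodgeStructure H) (hM : M.toSubmodule ≠ ⊤)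
    (h : ∀ T : SubMixedHodgeStructure H, M.toSubmodule ≤ T.toSubmodule → T.toSubmodule = M.toSubmodule ∨ T.toSubmodule = ⊤) :
    M.quotient.IsSimple := by
  refine ⟨Submodule.Quotient.nontrivial_iff.2 hM, fun T' => ?_⟩
  have hle : M.toSubmodule ≤ (T'.comap M.mkQ).toSubmodule := fun x hx => by
    rw [comap_toSubmodule, Submodule.mem_comap]
    have h0 : M.mkQ.toLinearMap x = 0 := (Submodule.Quotient.mk_eq_zero _).2 hx
    rw [h0]; exact Submodule.zero_mem _
  have key : T'.toSubmodule = (T'.toSubmodule.comap M.mkQ.toLinearMap).map M.mkQ.toLinearMap :=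
    (Submodule.map_comap_eq_of_surjective (Submodule.mkQ_surjective _) _).symm
  rcases h (T'.comap M.mkQ) hle with h' | h' <;> rw [comap_toSubmodule] at h'
  · left
    rw [key, h']
    exact Submodule.mkQ_map_self _
  · right
    rw [key, h', Submodule.map_top]
    exact Submodule.range_mkQ _

/-- **A non-zero MHS has a sub-MHS with simple quotient** (orthogonal of a simple sub-MHS of `H^∨`).
[cite: Fujiki1980, (1.6.2) b)] [cite: CattaniElZeinGriffithsLe2014, p. 270] -/
theorem exists_isSimple_quotient [Nontrivial V] (H : MixedHodgeStructure V) :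
    ∃ M : SubMixedHodgeStructure H, M.quotient.IsSimple := by
  obtain ⟨S', hS'⟩ := exists_subMixedHodgeStructure_isSimple H.dual
  exact ⟨S'.coannihilator, (isSimple_coannihilator_quotient_iff S').2 hS'⟩

end SubMixedHodgeStructure

open SubMixedHodgeStructure

/-! ### §2 The radical is the intersection of the maximal sub-MHS -/

/-- `rad H ⊆ M` whenever `H/M` is simple. [cite: CattaniElZeinGriffithsLe2014, p. 270] -/
theorem radical_le_of_isSimple_quotient (M : SubMixedHodgeStructure H) (hM : M.quotient.IsSimple) :
    (radical H).toSubmodule ≤ M.toSubmodule :=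
  radical_le M hM.isSemisimple

omit [FiniteDimensional ℚ V] in
/-- Linear algebra: the joint annihilator in `V` of a supremum of subspaces of `V^∨` is the intersection of the
annihilators. [cite: Fujiki1980, (1.6.2) b)] -/
theorem dualCoannihilator_iSup_eq {ι : Sort*} (U : ι → Submodule ℚ (Module.Dual ℚ V)) :
    (⨆ i, U i).dualCoannihilator = ⨅ i, (U i).dualCoannihilator := by
  refine le_antisymm (le_iInf fun i => Submodule.dualCoannihilator_anti (le_iSup U i)) fun x hx => ?_
  rw [Submodule.mem_dualCoannihilator]
  have hle : (⨆ i, U i) ≤ LinearMap.ker (Module.Dual.eval ℚ V x) :=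
    iSup_le fun i φ hφ => (Submodule.mem_dualCoannihilator x).1 (Submodule.mem_iInf _ |>.1 hx i) φ hφ
  exact fun φ hφ => hle hφ

/-- **`rad H = ⋂ { M : H/M simple }`** (dual to `soc H = Σ simple`). [cite: CattaniElZeinGriffithsLe2014, Thm. 3.2.18 and p. 270]
[cite: Fujiki1980, (1.6.2) b)] -/
theorem radical_toSubmodule_eq_iInf :
    (radical H).toSubmodule = ⨅ M : {M : SubMixedHodgeStructure H // M.quotient.IsSimple}, M.1.toSubmodule := by
  refine le_antisymm (le_iInf fun M => radical_le_of_isSimple_quotient M.1 M.2) ?_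
  -- `rad H = (soc H^∨)_⊥ = ⋂_{S' simple} S'_⊥`, and every `S'_⊥` is an `M` with simple quotient
  rw [← coannihilator_socle, coannihilator_toSubmodule, socle_toSubmodule_eq_iSup, dualCoannihilator_iSup_eq]
  refine le_iInf fun S' => ?_
  rw [← coannihilator_toSubmodule]
  exact iInf_le_of_le ⟨S'.1.coannihilator, (isSimple_coannihilator_quotient_iff S'.1).2 S'.2⟩ le_rfl

/-- **Membership in the radical**: `x ∈ rad H` iff `x ∈ M` for every sub-MHS `M` with `H/M` simple.
[cite: CattaniElZeinGriffithsLe2014, p. 270] -/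
theorem mem_radical_iff (x : V) :
    x ∈ (radical H).toSubmodule ↔ ∀ M : SubMixedHodgeStructure H, M.quotient.IsSimple → x ∈ M.toSubmodule := by
  rw [radical_toSubmodule_eq_iInf, Submodule.mem_iInf]
  exact ⟨fun h M hM => h ⟨M, hM⟩, fun h M => h M.1 M.2⟩

/-- `H` is semisimple iff its maximal sub-MHS have zero intersection. [cite: CattaniElZeinGriffithsLe2014, p. 270] -/
theorem isSemisimple_iff_iInf_eq_bot :
    H.IsSemisimple ↔ (⨅ M : {M : SubMixedHodgeStructure H // M.quotient.IsSimple}, M.1.toSubmodule) = ⊥ := by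
  rw [← radical_toSubmodule_eq_iInf, radical_eq_bot_iff]

end MixedHodgeStructure

end Literature.AlgebraicGeometry.Motives
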